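import Mathlib
import Literature.Analysis.ODE.InverseSquareLadder
import Literature.Analysis.ODE.InverseSquareLadderPreimage
import Literature.Analysis.PDE.DAlembertSmooth
import Literature.Analysis.PDE.InverseSquareLadderWave
import HarnessLib

/-!
# Global `C²` solutions of `φ_tt − φ_xx + n(n+1) ι² φ = 0` (`x > ½`) with prescribed Cauchy data

Analysis/PDE support file (everything proved). For `ι` smooth with `ι = 1/x` on `[½,∞)` (smooth
primitive `I`) and data `h ∈ C²`, `g ∈ C¹` on `ℝ`, the Darboux ladder of the d'Alembert wave with
pre-image data is a globally `C²` function `φ` with `φ(0,·) = h`, `∂ₜφ(0,·) = g`, solving the exact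
inverse-square equation `φ_tt = φ_xx − n(n+1)ι²φ` for `x > ½` (`exists_inverseSquare_wave`).
(Elsewhere on the line `φ` solves the equation with a continuous source — it is still globally `C²`,
which is all the energy bookkeeping needs.) Far-side comparison dynamics of `FixedModeChannels`
(route PhotonSphereChannels, stmt-FinalStateConjecture-10048). Folklore (Kenig–Lawrie–Liu–Schlag
2015, §2, in 1D form).
-/

noncomputable section

namespace Literature.Analysis.PDE

open Set Filter Topology Literature.Analysis.ODE

variable {ι : ℝ → ℝ}

/-- **Existence of exact inverse-square waves with given data.** [folklore] -/
theorem exists_inverseSquare_wave (hι : ContDiff ℝ (⊤ : ℕ∞) ι)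
    (hιeq : ∀ x : ℝ, 1 / 2 ≤ x → ι x = x⁻¹) {I : ℝ → ℝ} (hI : ContDiff ℝ (⊤ : ℕ∞) I)
    (hI' : ∀ x, HasDerivAt I (ι x) x) (n : ℕ) {h g : ℝ → ℝ} (hh : ContDiff ℝ 2 h)
    (hg : ContDiff ℝ 1 g) :
    ∃ φ : ℝ → ℝ → ℝ, ContDiff ℝ 2 (Function.uncurry φ) ∧
      (∀ t, ∀ x ∈ Ioi (1 / 2 : ℝ), iteratedDeriv 2 (fun τ => φ τ x) t
          = iteratedDeriv 2 (φ t) x - n * (n + 1) * ι x ^ 2 * φ t x) ∧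
      (∀ x, φ 0 x = h x) ∧ (∀ x, deriv (fun τ => φ τ x) 0 = g x) := by
  have hSo : IsOpen (Ioi (1 / 2 : ℝ)) := isOpen_Ioi
  have hric : ∀ x ∈ Ioi (1 / 2 : ℝ), deriv ι x = -(ι x) ^ 2 := by
    intro x hx
    have hx' : (1 / 2 : ℝ) < x := hx
    have hx0 : x ≠ 0 := by intro h0; rw [h0] at hx'; norm_num at hx'
    have hev : ι =ᶠ[𝓝 x] fun y => y⁻¹ :=
      Filter.mem_of_superset (Ioi_mem_nhds hx') fun y hy => hιeq y (le_of_lt hy)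
    rw [hev.deriv_eq, deriv_inv, hιeq x hx'.le]; field_simp
  -- pre-images (based at `0`, no jet condition: `j = 0`)
  obtain ⟨ht, htC, htlad, -, -⟩ := exists_ladder_preimage hI hI' 0 n (m := 2) (j := 0) hh (Nat.zero_le 2)
    (fun i hi => absurd hi (Nat.not_lt_zero i))
  obtain ⟨gt, gtC, gtlad, -, -⟩ := exists_ladder_preimage hI hI' 0 n (m := 1) (j := 0) hg (Nat.zero_le 1)
    (fun i hi => absurd hi (Nat.not_lt_zero i))
  have htC' : ContDiff ℝ (n + 2) ht := by
    have : ((2 + n : ℕ) : ℕ∞) = (n + 2 : ℕ) := by rw [add_comm]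
    exact_mod_cast (this ▸ htC)
  have gtC' : ContDiff ℝ (n + 1) gt := by
    have : ((1 + n : ℕ) : ℕ∞) = (n + 1 : ℕ) := by rw [add_comm]
    exact_mod_cast (this ▸ gtC)
  obtain ⟨Φ, F, G, hΦC, -, -, -, -, -, hfree, hd0, hv0, -, -⟩ :=
    exists_dAlembert_solution_contDiff htC' gtC'
  have hΦC' : ContDiff ℝ ((n + 2 : ℕ) : ℕ∞) (Function.uncurry Φ) := by exact_mod_cast hΦC
  obtain ⟨hφC2, hφsol⟩ := ladder_wave hι hSo hric (n := n) hΦC' hfree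
  refine ⟨fun t => ladder ι n (Φ t), hφC2, hφsol, fun x => ?_, fun x => ?_⟩
  · have hΦ0 : Φ 0 = ht := funext hd0
    show ladder ι n (Φ 0) x = h x
    rw [hΦ0, htlad]
  · show deriv (fun τ => ladder ι n (Φ τ) x) 0 = g x
    rw [deriv_ladder_param hι hΦC' 0 x]
    have : (fun y => deriv (fun τ => Φ τ y) 0) = gt := funext hv0
    rw [this, gtlad]

end Literature.Analysis.PDE
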